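import Literature.NumberTheory.Automorphic.ReciprocityGLn
import Literature.NumberTheory.Automorphic.AutomorphicTwistSatake
import HarnessLib

/-!
# Satake parameters of automorphic representations are non-zero — the proof

Topic `Literature/NumberTheory/Automorphic` (vocabulary of `AutomorphicRepsGL`:
`AutomorphicRepData (AutomorphyDatum.gl n K hcpt)`, `HasSatakeParamAt`; of `GLnAdelicStructure`:
`heckeDiagAt`, `glDiagonal`, `GLn.ofFinite`, `uniformizerIdele`, `principalCongruenceLevel`; of
`HeckeAlgebra`: `heckeOperator`).  A *proofs* file (theorems only): it DISCHARGES the named fact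
`Literature.NumberTheory.Automorphic.hasSatakeParamAt_ne_zero` of `Automorphic/ReciprocityGLn` (D-0014), by the argument
recorded in its docstring and already carried out in the tree for the `L²`-spectrum notion
`HasSatakeParameterAt` (`HasSatakeParameterAt.esymm_ne_zero`, `.zero_not_mem` of
`Automorphic/AutomorphicTwistSatake`): if `π = W / W'` has Satake parameter `α` at `v` then the
Hecke operator of `t_{v,n} = ϖ · 1_n` acts on the spherical vector `φ ∈ W ∖ W'` with eigenvalue
`q_v⁰ · e_n(α) = ∏_j α_j` modulo `W'`; but `t_{v,n}` is central (`heckeDiagAt_self_mem_center`),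
so this Hecke operator is right translation by `t_{v,n}` (`heckeOperator_apply_of_mem_center`),
an automorphism of `W` preserving `W'` (stability of `W'` under `GL_n(𝔸_K^∞) ∋ t_{v,n}`,
`heckeDiagAt_mem_range_ofFinite`); hence `∏_j α_j = 0` would force `φ ∈ W'`.

* `Literature.NumberTheory.Automorphic.heckeDiagAt_mem_range_ofFinite` — `t_{v,i} ∈ GL_n(𝔸_K^∞) ⊆ GL_n(𝔸_K)`.
* `Literature.Lang.hasSatakeParamAt_ne_zero_holds : hasSatakeParamAt_ne_zero`.

## References

* P. Cartier, *Representations of `p`-adic groups: a survey*, Corvallis (1979), §IV.2.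
  [CartierCorvallis1979]
* A. Borel, H. Jacquet, *Automorphic forms and automorphic representations*, Corvallis (1979),
  4.6. [BorelJacquet1979]
-/

noncomputable section

open scoped MatrixGroups Matrix Classical NumberField
open NumberField IsDedekindDomain

namespace Literature.NumberTheory.Automorphic

variable (n : ℕ) (K : Type) [Field K] [NumberField K]

/-- The Hecke element `t_{v,i} = diag(ϖ_v, …, ϖ_v, 1, …, 1) ∈ GL_n(𝔸_K)` lies in the image of
`GL_n(𝔸_K^∞)` (it is `GLn.ofFinite` of the corresponding finite-adelic diagonal matrix).
[folklore] -/
theorem heckeDiagAt_mem_range_ofFinite (v : HeightOneSpectrum (𝓞 K))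
    (ϖ : (v.adicCompletion K)ˣ) (i : ℕ) :
    heckeDiagAt n K v ϖ i ∈ (GLn.ofFinite n K).range := by
  refine ⟨glDiagonal n (FiniteAdeleRing (𝓞 K) K) fun k ↦
    if k.val < i then uniformizerIdele K v ϖ else 1, ?_⟩
  refine Matrix.GeneralLinearGroup.ext fun a b ↦ ?_
  rw [GLn.coe_ofFinite_apply, heckeDiagAt, coe_glDiagonal, coe_glDiagonal, Matrix.diagonal_apply,
    Matrix.diagonal_apply, Matrix.one_apply]
  by_cases hab : a = b
  · subst hab
    rw [if_pos rfl, if_pos rfl, if_pos rfl]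
    by_cases h : a.val < i
    · rw [if_pos h, if_pos h, Units.coe_map, MonoidHom.inr_apply]
    · rw [if_neg h, if_neg h]
      rfl
  · rw [if_neg hab, if_neg hab, if_neg hab]
    rfl

end Literature.NumberTheory.Automorphic

namespace Literature.NumberTheory.Automorphic


/-- **Satake parameters of automorphic representations are non-zero** — discharge of the named
fact `hasSatakeParamAt_ne_zero` (`Automorphic/ReciprocityGLn`): if `π = W / W'` has Satake
parameter `α` at `v` then `0 ∉ α`.  Proof: `e_n(α) = ∏_j α_j` (`card α = n`) is, modulo `W'`,
the eigenvalue on the spherical vector `φ ∈ W ∖ W'` of the Hecke operator of the central element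
`t_{v,n} = ϖ · 1_n`, which is right translation by `t_{v,n}` (`heckeOperator_apply_of_mem_center`,
`heckeDiagAt_self_mem_center`); if it vanished, `R(t_{v,n}) φ ∈ W'`, and applying
`R(t_{v,n}⁻¹)`, which preserves `W'` (`IsStableSubmodule.finite_stable`,
`heckeDiagAt_mem_range_ofFinite`), would give `φ ∈ W'`.  Cartier, Corvallis 1979, §IV.2.
[cite: CartierCorvallis1979, §IV.2] -/
theorem hasSatakeParamAt_ne_zero_holds : hasSatakeParamAt_ne_zero := by
  intro n K _ _ hcpt π v α hα a ha ha0
  subst ha0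
  obtain ⟨𝔫, ϖ, -, -, -, hcard, φ, hφW, hφW', hfix, hT⟩ := hα
  have hes : α.esymm n = 0 := by
    rw [← hcard, Multiset.esymm, Multiset.powersetCard_self, Multiset.map_singleton,
      Multiset.sum_singleton]
    exact Multiset.prod_eq_zero ha
  have key := hT n le_rfl
  have hfix' : φ ∈ (rightTranslation (AdelicGroupData.gl n K)).fixedPoints
      (principalCongruenceLevel n K 𝔫) :=
    (Representation.mem_fixedPoints _ _ _).2 hfix
  have e : heckeOperator (rightTranslation (AdelicGroupData.gl n K)) (principalCongruenceLevel n K 𝔫)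
      (heckeDiagAt n K v ϖ n) φ =
        rightTranslation (AdelicGroupData.gl n K) (heckeDiagAt n K v ϖ n) φ :=
    heckeOperator_apply_of_mem_center _ _ (heckeDiagAt_self_mem_center v ϖ) hfix'
  rw [hes, mul_zero, zero_smul, sub_zero, e] at key
  -- `R(t) φ ∈ W'`; apply `R(t⁻¹)`, which preserves `W'`
  set t := heckeDiagAt n K v ϖ n with ht
  have htinv : t⁻¹ ∈ (AutomorphyDatum.gl n K hcpt).finiteAdelic := by
    rw [AutomorphyDatum.gl_finiteAdelic]
    exact Subgroup.inv_mem _ (heckeDiagAt_mem_range_ofFinite n K v ϖ n)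
  have hback := π.stable'.finite_stable t⁻¹ htinv key
  rw [Submodule.mem_comap, ← Module.End.mul_apply, ← map_mul, inv_mul_cancel, map_one,
    Module.End.one_apply] at hback
  exact hφW' hback

end Literature.NumberTheory.Automorphic
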